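import Literature.NumberTheory.Irrationality.PAdicZetaValues.Hurwitz
import Literature.NumberTheory.LocalFields.VolkenbornIntegral
import Mathlib.Analysis.SpecificLimits.Normed
import Mathlib.NumberTheory.Padics.RingHoms
import HarnessLib

/-!
# Sprang 2020, Lemma 3.1 — PROOF of the named fact `sprang2020_lemma31`

J. Sprang, *Linear independence result for p-adic L-values*, Duke Math. J. 169 (2020) =
arXiv:1809.07714 [Sprang2020], §3 (p. 8):

> **Lemma 3.1.** Let `s > 1` be an integer and `x ∈ ℚ_p` with `|x|_p ≥ q_p`, then
> `ω(x)^{1−s} ζ_p(s, x) = (1/(s−1)) ∫_{ℤ_p} (x + t)^{1−s} dt`.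
>
> *Proof.* For `m ∈ ℤ` and `x ∈ ℚ_p` with `|x|_p ≥ q_p`, we get `ω(x) = ω(x + m)`. Unravelling the
> definition of the Volkenborn integral … gives
> `ζ_p(s, x) = (1/(s−1)) lim_{r→∞} p^{−r} Σ_{0≤m<p^r} ⟨x + m⟩^{1−s}`, and we conclude
> `ω(x)^{1−s} ζ_p(s, x) = … = (1/(s−1)) lim_{r→∞} p^{−r} Σ_{0≤m<p^r} (x + m)^{1−s}`. □

This file discharges `Literature.NumberTheory.Irrationality.PAdicZetaValues.sprang2020_lemma31`
(`Hurwitz.lean`) by `sprang2020_lemma31_holds`, making the two printed sentences explicit for the typed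
objects `teichmullerUnit` / `teichmuller` / `angle` / `padicHurwitzZeta` of `Hurwitz.lean`:

* §1 (folklore, private): powers of `p`-adic units — `‖aⁿ − bⁿ‖ ≤ ‖a − b‖`, the lifting step
  `‖a^p − b^p‖ ≤ p⁻¹‖a − b‖` for `‖a − b‖ ≤ p⁻¹`, Fermat `‖u^{p−1} − 1‖ ≤ p⁻¹` (via `ℤ_p → ℤ/p`,
  Mathlib `PadicInt.toZMod`), hence `‖u^{p^{k+1}} − u^{p^k}‖ ≤ p^{−(k+1)}`.
* §2: the typed Teichmüller representative — for odd `p` the sequence `u^{p^k}` CONVERGES to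
  `teichmullerUnit p u` (`tendsto_pow_teichmullerUnit`), `‖teichmullerUnit p u‖ = 1`, and
  `teichmullerUnit` is constant on balls of radius `q_p⁻¹` (`teichmullerUnit_congr`; for `p = 2` the
  typed `±1` test is decided modulo `4`).
* §3: "`ω(x) = ω(x + m)`" for `|x|_p ≥ q_p`, `m ∈ ℕ` (`teichmuller_add_natCast`: same valuation by the
  ultrametric equality, unit parts congruent modulo `q_p`), `ω(x) ≠ 0`, hence
  `⟨x + m⟩ = (x + m)/ω(x)` (`angle_add_natCast`).
* §4: existence of the Volkenborn integral `∫_{ℤ_p} (x + t)^{1−s} dt` ("analytic functions are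
  Volkenborn integrable", [Sprang2020, §2]): for `|x|_p > 1` and `t ∈ ℤ_p`,
  `(x + t)^{−(k+1)} = Σ_n tⁿ · x^{−(k+1)} C(n+k, k) (−x⁻¹)ⁿ` (Mathlib
  `hasSum_choose_mul_geometric_of_norm_lt_one`) with coefficients `→ 0`, so the TREE's
  `Literature.NumberTheory.LocalFields.tendsto_volkenbornSum_powerSeries` (Robert, *A Course in p-adic
  Analysis*, V.5.4 — `VolkenbornIntegral.lean`, REUSED) gives the limit of the Riemann sums
  (`tendsto_riemannSum_zpow_neg`).
* §5: the assembly `sprang2020_lemma31_holds`.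

Theorems only (no new definitions); the statement file `Hurwitz.lean` is untouched.
Cell pub-zeta5 (HONEST FRAMING: systematic search; no irrationality claim unless kernel-certified): a
`p`-adic bookkeeping lemma for the RECORD vocabulary; nothing here bears on `ζ(5) ∈ ℝ`.
-/

noncomputable section

open Filter Finset
open scoped Topology

namespace Literature.NumberTheory.Irrationality.PAdicZetaValues

variable {p : ℕ} [hp : Fact p.Prime]

/-! ## §1. Powers of `p`-adic units (folklore) -/

/-- `‖aⁿ − bⁿ‖ ≤ ‖a − b‖` for `‖a‖, ‖b‖ ≤ 1` (`aⁿ − bⁿ = (a − b) Σ aⁱbⁿ⁻¹⁻ⁱ`). [folklore] -/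
private theorem norm_pow_sub_pow_le {a b : ℚ_[p]} (ha : ‖a‖ ≤ 1) (hb : ‖b‖ ≤ 1) (n : ℕ) :
    ‖a ^ n - b ^ n‖ ≤ ‖a - b‖ := by
  rw [← geom_sum₂_mul, norm_mul]
  refine mul_le_of_le_one_left (norm_nonneg _) ?_
  refine IsUltrametricDist.norm_sum_le_of_forall_le_of_nonneg zero_le_one fun i _ => ?_
  rw [norm_mul, norm_pow, norm_pow]
  exact mul_le_one₀ (pow_le_one₀ (norm_nonneg _) ha) (pow_nonneg (norm_nonneg _) _)
    (pow_le_one₀ (norm_nonneg _) hb)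

/-- The lifting step: `‖a^p − b^p‖ ≤ p⁻¹ ‖a − b‖` for `‖a‖, ‖b‖ ≤ 1` with `‖a − b‖ ≤ p⁻¹`
(`Σ_{i<p} aⁱb^{p−1−i} = p·b^{p−1} + Σ_{i<p} (aⁱ − bⁱ) b^{p−1−i}` has norm `≤ p⁻¹`). [folklore] -/
private theorem norm_pow_prime_sub_pow_prime_le {a b : ℚ_[p]} (ha : ‖a‖ ≤ 1) (hb : ‖b‖ ≤ 1)
    (hab : ‖a - b‖ ≤ (p : ℝ)⁻¹) : ‖a ^ p - b ^ p‖ ≤ (p : ℝ)⁻¹ * ‖a - b‖ := by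
  rw [← geom_sum₂_mul, norm_mul]
  refine mul_le_mul_of_nonneg_right ?_ (norm_nonneg _)
  have hsplit : ∑ i ∈ range p, a ^ i * b ^ (p - 1 - i) =
      (p : ℚ_[p]) * b ^ (p - 1) + ∑ i ∈ range p, (a ^ i - b ^ i) * b ^ (p - 1 - i) := by
    have h : ∀ i ∈ range p,
        (a ^ i - b ^ i) * b ^ (p - 1 - i) = a ^ i * b ^ (p - 1 - i) - b ^ (p - 1) := by
      intro i hi
      have hi' := mem_range.1 hi
      rw [sub_mul, ← pow_add]
      congr 2
      omega
    rw [sum_congr rfl h, sum_sub_distrib, sum_const, card_range, nsmul_eq_mul]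
    ring
  rw [hsplit]
  refine (IsUltrametricDist.norm_add_le_max _ _).trans (max_le ?_ ?_)
  · rw [norm_mul, Padic.norm_p, norm_pow]
    exact mul_le_of_le_one_right (by positivity) (pow_le_one₀ (norm_nonneg _) hb)
  · refine IsUltrametricDist.norm_sum_le_of_forall_le_of_nonneg (by positivity) fun i _ => ?_
    rw [norm_mul, norm_pow]
    calc ‖a ^ i - b ^ i‖ * ‖b‖ ^ (p - 1 - i) ≤ ‖a - b‖ * 1 :=
          mul_le_mul (norm_pow_sub_pow_le ha hb i) (pow_le_one₀ (norm_nonneg _) hb)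
            (pow_nonneg (norm_nonneg _) _) (norm_nonneg _)
      _ ≤ (p : ℝ)⁻¹ := by rw [mul_one]; exact hab

/-- Fermat in `ℤ_p/pℤ_p`: for a unit `u` (`‖u‖ = 1`), `‖u^{p−1} − 1‖ ≤ p⁻¹`. [folklore] -/
private theorem norm_pow_pred_sub_one_le {u : ℚ_[p]} (hu : ‖u‖ = 1) :
    ‖u ^ (p - 1) - 1‖ ≤ (p : ℝ)⁻¹ := by
  set U : ℤ_[p] := ⟨u, hu.le⟩ with hU
  have hUnorm : ‖U‖ = 1 := hu
  have hne : PadicInt.toZMod U ≠ 0 := by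
    intro h0
    have hmem : U ∈ RingHom.ker (PadicInt.toZMod : ℤ_[p] →+* ZMod p) := h0
    rw [PadicInt.ker_toZMod, IsLocalRing.mem_maximalIdeal, PadicInt.mem_nonunits] at hmem
    exact absurd hUnorm (ne_of_lt hmem)
  have hker : U ^ (p - 1) - 1 ∈ RingHom.ker (PadicInt.toZMod : ℤ_[p] →+* ZMod p) := by
    rw [RingHom.mem_ker, map_sub, map_pow, map_one, ZMod.pow_card_sub_one_eq_one hne, sub_self]
  rw [PadicInt.ker_toZMod, IsLocalRing.mem_maximalIdeal, PadicInt.mem_nonunits] at hker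
  have h' : ‖U ^ (p - 1) - 1‖ ≤ (p : ℝ) ^ (-1 : ℤ) := by
    rw [PadicInt.norm_le_pow_iff_norm_lt_pow_add_one]
    norm_num
    exact hker
  have hcoe : ((U ^ (p - 1) - 1 : ℤ_[p]) : ℚ_[p]) = u ^ (p - 1) - 1 := by
    push_cast
    rfl
  rw [zpow_neg, zpow_one, PadicInt.norm_def, hcoe] at h'
  exact h'

/-- For a unit `u`: `‖u^{p^{k+1}} − u^{p^k}‖ ≤ p^{−(k+1)}`. [folklore] -/
private theorem norm_unitPow_succ_sub_le {u : ℚ_[p]} (hu : ‖u‖ = 1) (k : ℕ) :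
    ‖u ^ p ^ (k + 1) - u ^ p ^ k‖ ≤ ((p : ℝ)⁻¹) ^ (k + 1) := by
  induction k with
  | zero =>
    have hp1 : p = p - 1 + 1 := (Nat.sub_add_cancel hp.out.one_lt.le).symm
    have hfac : u ^ p ^ (0 + 1) - u ^ p ^ 0 = u * (u ^ (p - 1) - 1) := by
      rw [zero_add, pow_one, pow_zero, pow_one, mul_sub, mul_one, ← pow_succ']
      rw [← hp1]
    rw [hfac, norm_mul, hu, one_mul, zero_add, pow_one]
    exact norm_pow_pred_sub_one_le hu
  | succ k ih =>
    have hp0 : (0 : ℝ) ≤ (p : ℝ)⁻¹ := by positivity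
    have hp1 : (p : ℝ)⁻¹ ≤ 1 := inv_le_one_of_one_le₀ (by exact_mod_cast hp.out.one_lt.le)
    have ha : ‖u ^ p ^ (k + 1)‖ ≤ 1 := by rw [norm_pow, hu, one_pow]
    have hb : ‖u ^ p ^ k‖ ≤ 1 := by rw [norm_pow, hu, one_pow]
    have hab : ‖u ^ p ^ (k + 1) - u ^ p ^ k‖ ≤ (p : ℝ)⁻¹ := by
      refine ih.trans ?_
      calc ((p : ℝ)⁻¹) ^ (k + 1) ≤ ((p : ℝ)⁻¹) ^ 1 := pow_le_pow_of_le_one hp0 hp1 (by omega)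
        _ = (p : ℝ)⁻¹ := pow_one _
    have h := norm_pow_prime_sub_pow_prime_le ha hb hab
    rw [← pow_mul, ← pow_mul, ← pow_succ, ← pow_succ] at h
    calc ‖u ^ p ^ (k + 1 + 1) - u ^ p ^ (k + 1)‖ ≤ (p : ℝ)⁻¹ * ‖u ^ p ^ (k + 1) - u ^ p ^ k‖ := h
      _ ≤ (p : ℝ)⁻¹ * ((p : ℝ)⁻¹) ^ (k + 1) := by gcongr
      _ = ((p : ℝ)⁻¹) ^ (k + 1 + 1) := by ring

/-- For units `u, u'` with `‖u − u'‖ ≤ p⁻¹`: `‖u^{p^k} − u'^{p^k}‖ ≤ p⁻¹ · p^{−k}`. [folklore] -/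
private theorem norm_unitPow_sub_unitPow_le {u u' : ℚ_[p]} (hu : ‖u‖ = 1) (hu' : ‖u'‖ = 1)
    (h : ‖u - u'‖ ≤ (p : ℝ)⁻¹) (k : ℕ) :
    ‖u ^ p ^ k - u' ^ p ^ k‖ ≤ (p : ℝ)⁻¹ * ((p : ℝ)⁻¹) ^ k := by
  induction k with
  | zero => simpa using h
  | succ k ih =>
    have hp0 : (0 : ℝ) ≤ (p : ℝ)⁻¹ := by positivity
    have hp1 : (p : ℝ)⁻¹ ≤ 1 := inv_le_one_of_one_le₀ (by exact_mod_cast hp.out.one_lt.le)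
    have ha : ‖u ^ p ^ k‖ ≤ 1 := by rw [norm_pow, hu, one_pow]
    have hb : ‖u' ^ p ^ k‖ ≤ 1 := by rw [norm_pow, hu', one_pow]
    have hab : ‖u ^ p ^ k - u' ^ p ^ k‖ ≤ (p : ℝ)⁻¹ := by
      refine ih.trans ?_
      calc (p : ℝ)⁻¹ * ((p : ℝ)⁻¹) ^ k ≤ (p : ℝ)⁻¹ * 1 := by
            gcongr; exact pow_le_one₀ hp0 hp1
        _ = (p : ℝ)⁻¹ := mul_one _
    have h' := norm_pow_prime_sub_pow_prime_le ha hb hab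
    rw [← pow_mul, ← pow_mul, ← pow_succ] at h'
    calc ‖u ^ p ^ (k + 1) - u' ^ p ^ (k + 1)‖ ≤ (p : ℝ)⁻¹ * ‖u ^ p ^ k - u' ^ p ^ k‖ := h'
      _ ≤ (p : ℝ)⁻¹ * ((p : ℝ)⁻¹ * ((p : ℝ)⁻¹) ^ k) := by gcongr
      _ = (p : ℝ)⁻¹ * ((p : ℝ)⁻¹) ^ (k + 1) := by ring

/-! ## §2. The typed Teichmüller representative of a unit -/

/-- For odd `p` and a unit `u` (`|u|_p = 1`), the sequence `u^{p^k}` CONVERGES (it is Cauchy: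
`‖u^{p^{k+1}} − u^{p^k}‖ ≤ p^{−(k+1)}`), and its limit is the typed `teichmullerUnit p u` — the
Teichmüller representative `ω(u)`, "the canonical projection `ℤ_p^× → μ_{φ(q_p)}(ℤ_p)`".
[cite: Sprang2020, §3 (p. 8, the Teichmüller character)] -/
theorem tendsto_pow_teichmullerUnit (hp2 : p ≠ 2) {u : ℚ_[p]} (hu : ‖u‖ = 1) :
    Tendsto (fun k : ℕ => u ^ p ^ k) atTop (𝓝 (teichmullerUnit p u)) := by
  have hlt : (p : ℝ)⁻¹ < 1 := inv_lt_one_of_one_lt₀ (by exact_mod_cast hp.out.one_lt)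
  have hcauchy : CauchySeq (fun k : ℕ => u ^ p ^ k) := by
    refine cauchySeq_of_le_geometric ((p : ℝ)⁻¹) ((p : ℝ)⁻¹) hlt fun k => ?_
    rw [dist_eq_norm, norm_sub_rev]
    calc ‖u ^ p ^ (k + 1) - u ^ p ^ k‖ ≤ ((p : ℝ)⁻¹) ^ (k + 1) := norm_unitPow_succ_sub_le hu k
      _ = (p : ℝ)⁻¹ * ((p : ℝ)⁻¹) ^ k := by ring
  obtain ⟨L, hL⟩ := cauchySeq_tendsto_of_complete hcauchy
  have hval : teichmullerUnit p u = L := by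
    rw [teichmullerUnit, if_neg hp2]
    exact hL.limUnder_eq
  rw [hval]
  exact hL

/-- The Teichmüller representative of a unit is a unit: `|ω(u)|_p = 1` for `|u|_p = 1` (for `p = 2`
it is `±1`; for odd `p` it is a limit of units). [cite: Sprang2020, §3 (p. 8, `ω : ℤ_p^× → μ_{φ(q_p)}(ℤ_p)`)] -/
theorem norm_teichmullerUnit {u : ℚ_[p]} (hu : ‖u‖ = 1) : ‖teichmullerUnit p u‖ = 1 := by
  by_cases hp2 : p = 2
  · rw [teichmullerUnit, if_pos hp2]
    split_ifs <;> simp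
  · have h := (tendsto_pow_teichmullerUnit hp2 hu).norm
    have h1 : (fun k : ℕ => ‖u ^ p ^ k‖) = fun _ => (1 : ℝ) := by
      funext k
      rw [norm_pow, hu, one_pow]
    rw [h1] at h
    exact (tendsto_nhds_unique h tendsto_const_nhds).symm ▸ rfl

/-- `ω` is constant on residue classes modulo `q_p`: for units `u, u'` with `‖u − u'‖ ≤ q_p⁻¹`,
`ω(u) = ω(u')` (for `p = 2` the typed test `‖u − 1‖ < ½` is decided modulo `4`; for odd `p` the two
Cauchy sequences `u^{p^k}`, `u'^{p^k}` differ by a null sequence).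
[cite: Sprang2020, §3 (p. 8, `ℤ_p^× ≅ μ_{φ(q_p)}(ℤ_p) × (1 + q_p ℤ_p)`)] -/
theorem teichmullerUnit_congr {u u' : ℚ_[p]} (hu : ‖u‖ = 1) (hu' : ‖u'‖ = 1)
    (h : ‖u - u'‖ ≤ ((qp p : ℕ) : ℝ)⁻¹) : teichmullerUnit p u = teichmullerUnit p u' := by
  by_cases hp2 : p = 2
  · have hq : ((qp p : ℕ) : ℝ)⁻¹ < 2⁻¹ := by
      rw [qp, if_pos hp2]
      norm_num
    have hlt : ‖u - u'‖ < 2⁻¹ := h.trans_lt hq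
    rw [teichmullerUnit, teichmullerUnit, if_pos hp2, if_pos hp2]
    have key : ‖u - 1‖ < 2⁻¹ ↔ ‖u' - 1‖ < 2⁻¹ := by
      constructor
      · intro h1
        have e : u' - 1 = (u - 1) + (u' - u) := by ring
        rw [e]
        refine (IsUltrametricDist.norm_add_le_max _ _).trans_lt (max_lt h1 ?_)
        rwa [norm_sub_rev]
      · intro h1
        have e : u - 1 = (u' - 1) + (u - u') := by ring
        rw [e]
        exact (IsUltrametricDist.norm_add_le_max _ _).trans_lt (max_lt h1 hlt)
    by_cases h1 : ‖u - 1‖ < 2⁻¹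
    · rw [if_pos h1, if_pos (key.1 h1)]
    · rw [if_neg h1, if_neg (mt key.2 h1)]
  · have hq : ((qp p : ℕ) : ℝ)⁻¹ = (p : ℝ)⁻¹ := by rw [qp, if_neg hp2]
    rw [hq] at h
    have hlt : (p : ℝ)⁻¹ < 1 := inv_lt_one_of_one_lt₀ (by exact_mod_cast hp.out.one_lt)
    have h1 := tendsto_pow_teichmullerUnit hp2 hu
    have h2 := tendsto_pow_teichmullerUnit hp2 hu'
    have hdiff : Tendsto (fun k : ℕ => u ^ p ^ k - u' ^ p ^ k) atTop (𝓝 0) := by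
      refine squeeze_zero_norm (fun k => norm_unitPow_sub_unitPow_le hu hu' h k) ?_
      have h0 := (tendsto_pow_atTop_nhds_zero_of_lt_one (by positivity : (0 : ℝ) ≤ (p : ℝ)⁻¹)
        hlt).const_mul ((p : ℝ)⁻¹)
      rwa [mul_zero] at h0
    have h3 : Tendsto (fun k : ℕ => (u ^ p ^ k - u' ^ p ^ k) + u' ^ p ^ k) atTop
        (𝓝 (0 + teichmullerUnit p u')) := hdiff.add h2
    simp only [sub_add_cancel, zero_add] at h3
    exact tendsto_nhds_unique h1 h3

/-! ## §3. "`ω(x) = ω(x + m)`" for `|x|_p ≥ q_p` -/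

/-- `1 < q_p`. [cite: Sprang2020, §3 (display before Lemma 3.1, `q_p := p` or `4`)] -/
theorem one_lt_qp : 1 < qp p := by
  rw [qp]
  split_ifs
  · norm_num
  · exact hp.out.one_lt

/-- `|x|_p ≥ q_p` forces `|x|_p > 1`. [cite: Sprang2020, §3 Lemma 3.1 (hypothesis `|x|_p ≥ q_p`)] -/
theorem one_lt_norm_of_qp_le {x : ℚ_[p]} (hx : ((qp p : ℕ) : ℝ) ≤ ‖x‖) : 1 < ‖x‖ := by
  have h1 : (1 : ℝ) < ((qp p : ℕ) : ℝ) := by exact_mod_cast one_lt_qp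
  exact h1.trans_le hx

/-- `‖m‖ ≤ 1` for a natural number `m` in `ℚ_p`. [folklore] -/
private theorem norm_natCast_le_one (m : ℕ) : ‖(m : ℚ_[p])‖ ≤ 1 := by
  have h := Padic.norm_int_le_one (p := p) (m : ℤ)
  rwa [Int.cast_natCast] at h

/-- For `1 < ‖x‖`: `x ≠ 0`. [folklore] -/
private theorem ne_zero_of_one_lt_norm {x : ℚ_[p]} (hx : 1 < ‖x‖) : x ≠ 0 := by
  intro h
  rw [h, norm_zero] at hx
  exact absurd hx (by norm_num)

/-- For `1 < ‖x‖` and `m ∈ ℕ`: `‖x + m‖ = ‖x‖` (ultrametric equality). [folklore] -/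
private theorem norm_add_natCast_eq {x : ℚ_[p]} (hx : 1 < ‖x‖) (m : ℕ) :
    ‖x + (m : ℚ_[p])‖ = ‖x‖ := by
  have hm := norm_natCast_le_one (p := p) m
  have hne : ‖x‖ ≠ ‖(m : ℚ_[p])‖ := ne_of_gt (hm.trans_lt hx)
  rw [Padic.add_eq_max_of_ne hne, max_eq_left (hm.trans hx.le)]

/-- For `1 < ‖x‖` and `m ∈ ℕ`: `ν_p(x + m) = ν_p(x)`. [folklore] -/
private theorem valuation_add_natCast_eq {x : ℚ_[p]} (hx : 1 < ‖x‖) (m : ℕ) :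
    (x + (m : ℚ_[p])).valuation = x.valuation := by
  have hx0 : x ≠ 0 := ne_zero_of_one_lt_norm hx
  have h := norm_add_natCast_eq hx m
  have hxm0 : x + (m : ℚ_[p]) ≠ 0 := by
    apply ne_zero_of_one_lt_norm
    rw [h]
    exact hx
  rw [Padic.norm_eq_zpow_neg_valuation hxm0, Padic.norm_eq_zpow_neg_valuation hx0,
    zpow_right_inj₀ (by exact_mod_cast hp.out.pos) (by exact_mod_cast hp.out.ne_one), neg_inj] at h
  exact h

/-- The unit part `x · p^{−ν_p(x)}` of `x ≠ 0` has norm `1`. [folklore] -/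
private theorem norm_mul_zpow_neg_valuation {x : ℚ_[p]} (hx0 : x ≠ 0) :
    ‖x * (p : ℚ_[p]) ^ (-x.valuation)‖ = 1 := by
  rw [norm_mul, Padic.norm_p_zpow, neg_neg, Padic.norm_eq_zpow_neg_valuation hx0,
    ← zpow_add₀ (by exact_mod_cast hp.out.ne_zero : (p : ℝ) ≠ 0), neg_add_cancel, zpow_zero]

/-- **"For `m ∈ ℤ` and `x ∈ ℚ_p` with `|x|_p ≥ q_p`, we get `ω(x) = ω(x + m)`"** (here `m ∈ ℕ`): `x`
and `x + m` have the same valuation `v` and unit parts `u, u + m p^{−v}` congruent modulo `q_p`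
(`|m p^{−v}|_p ≤ p^{v} = |x|_p⁻¹ ≤ q_p⁻¹`). [cite: Sprang2020, §3 proof of Lemma 3.1] -/
theorem teichmuller_add_natCast {x : ℚ_[p]} (hx : ((qp p : ℕ) : ℝ) ≤ ‖x‖) (m : ℕ) :
    teichmuller p (x + m) = teichmuller p x := by
  have hx1 : 1 < ‖x‖ := one_lt_norm_of_qp_le hx
  have hx0 : x ≠ 0 := ne_zero_of_one_lt_norm hx1
  have hv := valuation_add_natCast_eq hx1 m
  unfold teichmuller
  rw [hv]
  congr 1
  have hu : ‖x * (p : ℚ_[p]) ^ (-x.valuation)‖ = 1 := norm_mul_zpow_neg_valuation hx0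
  have hu' : ‖(x + (m : ℚ_[p])) * (p : ℚ_[p]) ^ (-x.valuation)‖ = 1 := by
    rw [norm_mul, norm_add_natCast_eq hx1 m, ← norm_mul]
    exact hu
  refine teichmullerUnit_congr hu' hu ?_
  have hdiff : (x + (m : ℚ_[p])) * (p : ℚ_[p]) ^ (-x.valuation) - x * (p : ℚ_[p]) ^ (-x.valuation) =
      (m : ℚ_[p]) * (p : ℚ_[p]) ^ (-x.valuation) := by ring
  have hpv : (p : ℝ) ^ x.valuation = ‖x‖⁻¹ := by
    rw [Padic.norm_eq_zpow_neg_valuation hx0, zpow_neg, inv_inv]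
  have hq0 : (0 : ℝ) < ((qp p : ℕ) : ℝ) := by
    have := one_lt_qp (p := p)
    positivity
  rw [hdiff, norm_mul, Padic.norm_p_zpow, neg_neg]
  calc ‖(m : ℚ_[p])‖ * (p : ℝ) ^ x.valuation ≤ 1 * (p : ℝ) ^ x.valuation := by
        gcongr
        exact norm_natCast_le_one m
    _ = ‖x‖⁻¹ := by rw [one_mul, hpv]
    _ ≤ ((qp p : ℕ) : ℝ)⁻¹ := inv_anti₀ hq0 hx

/-- `ω(x) ≠ 0` for `x ≠ 0` (`ω(x) = p^{ν_p(x)} ω(u)` with `|ω(u)|_p = 1`): `ω : ℚ_p^× → ℚ_p^×`.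
[cite: Sprang2020, §3 (p. 8, extension of `ω` to `ℚ_p^× → ℚ_p^×`)] -/
theorem teichmuller_ne_zero {x : ℚ_[p]} (hx0 : x ≠ 0) : teichmuller p x ≠ 0 := by
  unfold teichmuller
  refine mul_ne_zero (zpow_ne_zero _ (by exact_mod_cast hp.out.ne_zero)) ?_
  rw [← norm_ne_zero_iff, norm_teichmullerUnit (norm_mul_zpow_neg_valuation hx0)]
  exact one_ne_zero

/-- `⟨x + m⟩ = (x + m)/ω(x)` for `|x|_p ≥ q_p`, `m ∈ ℕ`. [cite: Sprang2020, §3 proof of Lemma 3.1] -/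
theorem angle_add_natCast {x : ℚ_[p]} (hx : ((qp p : ℕ) : ℝ) ≤ ‖x‖) (m : ℕ) :
    angle p (x + m) = (x + m) / teichmuller p x := by
  rw [angle, teichmuller_add_natCast hx m]

/-! ## §4. Volkenborn integrability of `t ↦ (x + t)^{−(k+1)}` for `|x|_p > 1` -/

/-- The binomial (restricted power series) expansion on `ℤ_p`: for `|x|_p > 1`, `t ∈ ℤ_p`,
`(x + t)^{−(k+1)} = Σ_n tⁿ · x^{−(k+1)} C(n+k, k) (−x⁻¹)ⁿ` (geometric series `|t/x|_p < 1`). [folklore] -/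
private theorem hasSum_inv_pow_add {x : ℚ_[p]} (hx : 1 < ‖x‖) (t : ℤ_[p]) (k : ℕ) :
    HasSum (fun n : ℕ => ((t : ℚ_[p]) ^ n) *
        ((x ^ (k + 1))⁻¹ * (((n + k).choose k : ℕ) : ℚ_[p]) * (-x⁻¹) ^ n))
      (((x + (t : ℚ_[p])) ^ (k + 1))⁻¹) := by
  have hx0 : x ≠ 0 := ne_zero_of_one_lt_norm hx
  set r : ℚ_[p] := (t : ℚ_[p]) * (-x⁻¹) with hr
  have hrn : ‖r‖ < 1 := by
    rw [hr, norm_mul, norm_neg, norm_inv]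
    calc ‖(t : ℚ_[p])‖ * ‖x‖⁻¹ ≤ 1 * ‖x‖⁻¹ := by
          gcongr
          exact PadicInt.norm_le_one t
      _ < 1 := by rw [one_mul]; exact inv_lt_one_of_one_lt₀ hx
  have h := (hasSum_choose_mul_geometric_of_norm_lt_one k hrn).mul_left ((x ^ (k + 1))⁻¹)
  have hval : (x ^ (k + 1))⁻¹ * (1 / (1 - r) ^ (k + 1)) = ((x + (t : ℚ_[p])) ^ (k + 1))⁻¹ := by
    rw [one_div, ← mul_inv, ← mul_pow]
    congr 2
    rw [hr]
    field_simp
    ring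
  rw [hval] at h
  have key : ∀ n : ℕ, ((t : ℚ_[p]) ^ n) *
      ((x ^ (k + 1))⁻¹ * (((n + k).choose k : ℕ) : ℚ_[p]) * (-x⁻¹) ^ n) =
      (x ^ (k + 1))⁻¹ * ((((n + k).choose k : ℕ) : ℚ_[p]) * r ^ n) := fun n => by
    rw [hr, mul_pow]
    ring
  simp_rw [key]
  exact h

/-- The coefficients `x^{−(k+1)} C(n+k, k) (−x⁻¹)ⁿ → 0` (`|x⁻¹|_p < 1`, `|C(n+k,k)|_p ≤ 1`). [folklore] -/
private theorem tendsto_coeff_zero {x : ℚ_[p]} (hx : 1 < ‖x‖) (k : ℕ) :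
    Tendsto (fun n : ℕ => (x ^ (k + 1))⁻¹ * (((n + k).choose k : ℕ) : ℚ_[p]) * (-x⁻¹) ^ n)
      atTop (𝓝 0) := by
  refine squeeze_zero_norm (a := fun n => ‖(x ^ (k + 1))⁻¹‖ * ‖x⁻¹‖ ^ n) (fun n => ?_) ?_
  · rw [norm_mul, norm_mul, norm_pow, norm_neg]
    calc ‖(x ^ (k + 1))⁻¹‖ * ‖(((n + k).choose k : ℕ) : ℚ_[p])‖ * ‖x⁻¹‖ ^ n
        ≤ ‖(x ^ (k + 1))⁻¹‖ * 1 * ‖x⁻¹‖ ^ n := by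
          gcongr
          exact norm_natCast_le_one _
      _ = ‖(x ^ (k + 1))⁻¹‖ * ‖x⁻¹‖ ^ n := by rw [mul_one]
  · have hlt : ‖x⁻¹‖ < 1 := by
      rw [norm_inv]
      exact inv_lt_one_of_one_lt₀ hx
    have h := (tendsto_pow_atTop_nhds_zero_of_lt_one (norm_nonneg x⁻¹) hlt).const_mul
      ‖(x ^ (k + 1))⁻¹‖
    rwa [mul_zero] at h

/-- **The Volkenborn integral `∫_{ℤ_p} (x + t)^{−(k+1)} dt` exists** for `|x|_p > 1` ("analytic
functions are Volkenborn integrable"): the Riemann sums `p^{−r} Σ_{m<p^r} (x + m)^{−(k+1)}` converge —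
to `Σ_n b_n · x^{−(k+1)} C(n+k, k) (−x⁻¹)ⁿ` by the term-by-term integration of restricted power series
(the tree's `LocalFields.tendsto_volkenbornSum_powerSeries`, Robert V.5.4).
[cite: Sprang2020, §2 (p. 6, "continuously differentiable functions and analytic functions are Volkenborn integrable") and §3 Lemma 3.1] -/
theorem tendsto_riemannSum_zpow_neg {x : ℚ_[p]} (hx : 1 < ‖x‖) (k : ℕ) :
    Tendsto (fun r : ℕ => (p : ℚ_[p]) ^ (-(r : ℤ)) *
        ∑ m ∈ range (p ^ r), (x + (m : ℚ_[p])) ^ (-((k : ℤ) + 1))) atTop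
      (𝓝 (∑' n : ℕ, ((bernoulli n : ℚ) : ℚ_[p]) *
        ((x ^ (k + 1))⁻¹ * (((n + k).choose k : ℕ) : ℚ_[p]) * (-x⁻¹) ^ n))) := by
  have h := Literature.NumberTheory.LocalFields.tendsto_volkenbornSum_powerSeries (p := p)
    (F := ℚ_[p]) (tendsto_coeff_zero hx k)
  simp only [smul_eq_mul] at h
  refine Tendsto.congr (fun r => ?_) h
  rw [Literature.NumberTheory.LocalFields.volkenbornSum_def, smul_eq_mul, ← zpow_natCast, ← zpow_neg]
  congr 1
  refine sum_congr rfl fun m _ => ?_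
  rw [(hasSum_inv_pow_add hx (m : ℤ_[p]) k).tsum_eq, PadicInt.coe_natCast, ← zpow_natCast, ← zpow_neg]
  norm_cast

/-! ## §5. Lemma 3.1 -/

/-- **Sprang 2020, Lemma 3.1, PROVED** (discharge of the named fact `sprang2020_lemma31`): for a prime
`p`, an integer `s > 1` and `x ∈ ℚ_p` with `|x|_p ≥ q_p`, the Riemann sums
`p^{−r} Σ_{m<p^r} (x + m)^{1−s}` converge to some `V` (the Volkenborn integral
`∫_{ℤ_p} (x + t)^{1−s} dt`) and `ω(x)^{1−s} ζ_p(s, x) = (1/(s−1)) V`. Proof as printed: `ω(x + m) = ω(x)`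
for every `m`, so `⟨x + m⟩^{1−s} = (x + m)^{1−s} ω(x)^{s−1}` termwise in the defining limit of `ζ_p(s, x)`.
[cite: Sprang2020, §3 Lemma 3.1] -/
theorem sprang2020_lemma31_holds : sprang2020_lemma31 := by
  intro p _ s x hs hx
  obtain ⟨k, hk⟩ : ∃ k : ℕ, s = k + 2 := ⟨s - 2, by omega⟩
  have hexp : (1 - (s : ℤ)) = -((k : ℤ) + 1) := by omega
  have hx1 : 1 < ‖x‖ := one_lt_norm_of_qp_le hx
  have hx0 : x ≠ 0 := ne_zero_of_one_lt_norm hx1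
  have hV := tendsto_riemannSum_zpow_neg hx1 k
  rw [← hexp] at hV
  refine ⟨_, hV, ?_⟩
  set V : ℚ_[p] := ∑' n : ℕ, ((bernoulli n : ℚ) : ℚ_[p]) *
    ((x ^ (k + 1))⁻¹ * (((n + k).choose k : ℕ) : ℚ_[p]) * (-x⁻¹) ^ n) with hVdef
  have hω0 : teichmuller p x ≠ 0 := teichmuller_ne_zero hx0
  have hωs : teichmuller p x ^ (1 - (s : ℤ)) ≠ 0 := zpow_ne_zero _ hω0
  have hG : (fun r : ℕ => (p : ℚ_[p]) ^ (-(r : ℤ)) *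
      ∑ m ∈ Finset.range (p ^ r), angle p (x + m) ^ (1 - (s : ℤ))) =
      fun r : ℕ => ((p : ℚ_[p]) ^ (-(r : ℤ)) *
        ∑ m ∈ Finset.range (p ^ r), (x + (m : ℚ_[p])) ^ (1 - (s : ℤ))) /
          teichmuller p x ^ (1 - (s : ℤ)) := by
    funext r
    simp only [angle_add_natCast hx, div_zpow]
    rw [← sum_div, mul_div_assoc]
  have hlim : Tendsto (fun r : ℕ => (p : ℚ_[p]) ^ (-(r : ℤ)) *
      ∑ m ∈ Finset.range (p ^ r), angle p (x + m) ^ (1 - (s : ℤ))) atTop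
      (𝓝 (V / teichmuller p x ^ (1 - (s : ℤ)))) := by
    rw [hG]
    exact hV.div_const _
  rw [padicHurwitzZeta_def, hlim.limUnder_eq]
  calc teichmuller p x ^ (1 - (s : ℤ)) * (1 / ((s : ℚ_[p]) - 1) * (V / teichmuller p x ^ (1 - (s : ℤ))))
      = 1 / ((s : ℚ_[p]) - 1) * (V / teichmuller p x ^ (1 - (s : ℤ)) * teichmuller p x ^ (1 - (s : ℤ))) := by
        ring
    _ = 1 / ((s : ℚ_[p]) - 1) * V := by rw [div_mul_cancel₀ V hωs]

end Literature.NumberTheory.Irrationality.PAdicZetaValues
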